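import Mathlib
import Summits.QuantumFields.QCD.Theses.WilsonQuarkChessboard
import Literature.MathematicalPhysics.QuantumLattice.WilsonDiracAP
import Literature.Probability.LatticeModels.TorusFourierProofs
import Summits.QuantumFields.QCD.Theorems.QuarksAsStableActionCriticalLineDiamagnetismStubFreeBlochBlocks

/-!
# Torus-Fourier inversion of a translation-invariant lattice Dirac operator, any colour index —
auxiliary file
(helper for crux stmt-QuantumFields-9307 `FlatCellOptimal`, line `registered`, stub
`stub_hessianMarginAllN`, sub-goal `stub_freeTwistedFourierAuxAllN` (companion: `stub_freeTwistedFourierAllN`)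
— the `Fin 3 ↦ Fin N` port of the sibling crux stmt-QuantumFields-9736's
`…WilsonQuarkStabilityStubFreeTwistedFourierAux`, gap G2a, wave 3)

The model-independent half of the torus-Fourier inversion of a translation-invariant lattice Dirac
operator on `(ℤ/L)⁴ × colour × spin (Fin 4)`, for an ARBITRARY finite colour index type `n` (the sibling
file is the case `n = Fin 3`; the free operator is `scalar ⊗ 1_n`, so nothing depends on `n` except the
multiplicity `4·|n|` of each momentum in the determinant):

* `Abstract` (any index type; colour-free declarations of the sibling files
  `…WilsonQuarkStabilityStubFreeTwistedFourierAux`, `…CriticalLineDiamagnetismStubFreeDetFormula` /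
  `…StubFreeBlochBlocks` (stmt-QuantumFields-9734), `HeatSlicedQuarksFreeKernelPowerCountingFourier` and
  `SpectralDefectExtinctionTipNoBindingFreeSymbol`, imported and re-EXPORTED into this namespace — aliases,
  no restatement): if `Pᴴ P = 1` and `(A P)ᴴ (A P) = diagonal d` with a real,
  nowhere-vanishing `d`, then `AᴴA = P · diagonal d · Pᴴ`, `det A ≠ 0`, `(AᴴA)⁻¹ = P · diagonal (1/d) · Pᴴ`,
  `A⁻¹ = P · diagonal (1/d) · (AP)ᴴ`, with their entrywise forms; `‖det A‖² = ∏ d`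
  (`norm_sq_det_of_diag`); `Σ_i ‖(Q u)_i‖² = Σ_q d(q) ‖u_q‖²` for `Qᴴ Q = diagonal d`
  (`sum_norm_sq_mulVec_of_gram_diagonal`); the Clifford identity `M(k)ᴴ M(k) = h(k)·1` of the colour–spin
  symbol (`clifford_conjTranspose_mul_self`) and plane-wave orthonormality `Fᴴ F = 1`, `F(x,k) = L⁻² χ_k(x)`
  (`planeF_conjTranspose_mul_self`).
* `PlaneWave` (colour index `n`): the plane-wave matrix `P = F ⊗ 1` on sites × (`n` × spin) is an
  isometry (`planeP_conjTranspose_mul_self`); if `A P = Q`, `Q(p,q) = F(p.1,q.1) · (1_n ⊗ S(q.1))(p.2,q.2)`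
  for spin blocks with `S(k)ᴴ S(k) = d(k)·1`, then `Qᴴ Q = diagonal (d ∘ fst)` (character orthogonality,
  `symQ_conjTranspose_mul_self_of`), hence `‖det A‖² = ∏_k d(k)^{4|n|}` (`norm_sq_det_of_planeWave`),
  `c ≤ d ⇒ c Σ‖v‖² ≤ Σ‖Av‖²` (`coercive_of_planeWave`), and for `d ≠ 0`: `det A ≠ 0`,
  `(AᴴA)⁻¹((x,s),(y,s')) = δ_{ss'} L⁻⁴ Σ_k χ_k(x) conj χ_k(y) / d(k)` and
  `A⁻¹((x,a,α),(y,b,β)) = δ_{ab} L⁻⁴ Σ_k χ_k(x) conj χ_k(y) (S(k)ᴴ)_{αβ} / d(k)`.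

The companion file `…StubFreeTwistedFourierAllN.lean` feeds in the free Wilson–Dirac operator of
constant central `U(N)` links `e^{iθ_μ}·1`.  References: Montvay–Münster, *Quantum Fields on a Lattice*
§4.2 (free Wilson fermions in momentum space); folklore linear algebra.  Pure theorem file (no `def`s).
-/

namespace Summit.QuantumFields.QCD.Cruxes.FlatCellOptimal.FreeTwistedFourier

open Literature.MathematicalPhysics Literature.MathematicalPhysics.QuantumLattice
  Literature.MathematicalPhysics.QuantumFieldTheory Literature.Probability.LatticeModels
open Matrix Complex
open scoped Kronecker ComplexOrder ComplexConjugate BigOperators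

noncomputable section

/-! ### Abstract step (colour-free lemmas of the sibling files, re-exported) -/

export Summit.QuantumFields.QCD.Cruxes.WilsonQuarkStability.FreeTangentLandauChessboard
  (conjTranspose_mul_self_eq_of_diag det_ne_zero_of_diag planeInv_mul_conjTranspose_mul_self
    inv_conjTranspose_mul_self_eq inv_eq_of_diag inv_conjTranspose_mul_self_apply inv_apply_of_diag)

export Summit.QuantumFields.QCD.Theorems.HeatSlicedQuarks.FreeKernel
  (planeF_conjTranspose_mul_self conj_one_apply)

export Summit.QuantumFields.QCD.Cruxes.TipNoBinding.PositivityNoLeakSpread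
  (clifford_conjTranspose_mul_self sum_norm_sq_mulVec_of_conjTranspose_mul_self)

export Summit.QuantumFields.QCD.Cruxes.CriticalLineDiamagnetism.ChessboardCellGain.FreeDetFormula
  (norm_sq_det_of_diag)

export Summit.QuantumFields.QCD.Cruxes.CriticalLineDiamagnetism.ChessboardCellGain.FreeBlochBlocks
  (sum_norm_sq_mulVec_of_gram_diagonal)

/-! ### Plane waves on `(ℤ/L)⁴ × colour × spin`: inverses from a normalised colour–spin symbol -/

section PlaneWave

variable {L : ℕ} [NeZero L] {n : Type*} [Fintype n] [DecidableEq n]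

/-- The plane-wave matrix `P = F ⊗ 1` on sites × (any finite index `n`) is an isometry: `Pᴴ P = 1`. -/
theorem planeP_conjTranspose_mul_self :
    ((Matrix.of fun x k : TorusSite 4 L => ((L : ℂ) ^ 2)⁻¹ * torusChar k x) ⊗ₖ (1 : Matrix n n ℂ))ᴴ *
        ((Matrix.of fun x k : TorusSite 4 L => ((L : ℂ) ^ 2)⁻¹ * torusChar k x) ⊗ₖ (1 : Matrix n n ℂ)) =
      1 := by
  rw [conjTranspose_kronecker, ← mul_kronecker_mul, planeF_conjTranspose_mul_self, conjTranspose_one,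
    Matrix.one_mul, one_kronecker_one]

/-- **`Qᴴ Q` is diagonal**: if every spin block is normalised, `S(k)ᴴ S(k) = d(k)·1`, the matrix
`Q(p,q) = F(p.1,q.1) · (1_n ⊗ S(q.1))(p.2,q.2)`, `F(x,k) = L⁻² χ_k(x)`, has `Qᴴ Q = diagonal (d ∘ fst)`
(plane-wave orthonormality `Fᴴ F = 1` in the site factor). -/
theorem symQ_conjTranspose_mul_self_of (S : TorusSite 4 L → Matrix (Fin 4) (Fin 4) ℂ)
    (d : TorusSite 4 L → ℝ) (hS : ∀ k, (S k)ᴴ * S k = ((d k : ℝ) : ℂ) • (1 : Matrix (Fin 4) (Fin 4) ℂ)) :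
    (Matrix.of fun p q : TorusSite 4 L × n × Fin 4 =>
        (Matrix.of fun x k : TorusSite 4 L => ((L : ℂ) ^ 2)⁻¹ * torusChar k x) p.1 q.1 *
          ((1 : Matrix n n ℂ) ⊗ₖ S q.1) p.2 q.2)ᴴ *
        (Matrix.of fun p q : TorusSite 4 L × n × Fin 4 =>
          (Matrix.of fun x k : TorusSite 4 L => ((L : ℂ) ^ 2)⁻¹ * torusChar k x) p.1 q.1 *
            ((1 : Matrix n n ℂ) ⊗ₖ S q.1) p.2 q.2) =
      diagonal fun q : TorusSite 4 L × n × Fin 4 => ((d q.1 : ℝ) : ℂ) := by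
  ext q q'
  obtain ⟨k, s₀⟩ := q
  obtain ⟨k', s₀'⟩ := q'
  rw [Matrix.mul_apply, Fintype.sum_prod_type, Matrix.diagonal_apply]
  have hs : ∀ (x : TorusSite 4 L) (s : n × Fin 4),
      (Matrix.of fun p q : TorusSite 4 L × n × Fin 4 =>
          (Matrix.of fun x k : TorusSite 4 L => ((L : ℂ) ^ 2)⁻¹ * torusChar k x) p.1 q.1 *
            ((1 : Matrix n n ℂ) ⊗ₖ S q.1) p.2 q.2)ᴴ (k, s₀) (x, s) *
        (Matrix.of fun p q : TorusSite 4 L × n × Fin 4 =>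
          (Matrix.of fun x k : TorusSite 4 L => ((L : ℂ) ^ 2)⁻¹ * torusChar k x) p.1 q.1 *
            ((1 : Matrix n n ℂ) ⊗ₖ S q.1) p.2 q.2) (x, s) (k', s₀') =
        ((Matrix.of fun x k : TorusSite 4 L => ((L : ℂ) ^ 2)⁻¹ * torusChar k x)ᴴ k x *
            (Matrix.of fun x k : TorusSite 4 L => ((L : ℂ) ^ 2)⁻¹ * torusChar k x) x k') *
          ((((1 : Matrix n n ℂ) ⊗ₖ S k)ᴴ s₀ s) * (((1 : Matrix n n ℂ) ⊗ₖ S k') s s₀')) := by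
    intro x s
    simp only [Matrix.conjTranspose_apply, Matrix.of_apply, star_mul']
    ring
  simp_rw [hs]
  rw [← Finset.sum_mul_sum, ← Matrix.mul_apply, ← Matrix.mul_apply, planeF_conjTranspose_mul_self,
    Matrix.one_apply]
  by_cases hk : k = k'
  · subst hk
    rw [if_pos rfl, one_mul, conjTranspose_kronecker, ← mul_kronecker_mul, conjTranspose_one,
      Matrix.one_mul, hS, Matrix.kronecker_smul, one_kronecker_one, Matrix.smul_apply, Matrix.one_apply,
      smul_eq_mul, mul_ite, mul_one, mul_zero]
    simp only [Prod.mk.injEq, true_and]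
  · rw [if_neg hk, zero_mul, if_neg (fun h => hk (Prod.mk.injEq _ _ _ _ ▸ h).1)]

/-- **`‖det A‖²` from a plane-wave diagonalisation.**  If `A P = Q` for the unitary plane-wave matrix
`P = F ⊗ 1`, `F(x,k) = L⁻² χ_k(x)`, with `Q(p,q) = F(p.1,q.1) · (1_n ⊗ S(q.1))(p.2,q.2)` and normalised
spin blocks `S(k)ᴴ S(k) = d(k)·1` (`d` real), then `‖det A‖² = ∏_k d(k)^(4|n|)`
(`4|n| = |n × Fin 4|` colour–spin components per momentum). -/
theorem norm_sq_det_of_planeWave (S : TorusSite 4 L → Matrix (Fin 4) (Fin 4) ℂ)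
    (d : TorusSite 4 L → ℝ)
    (hS : ∀ k, (S k)ᴴ * S k = ((d k : ℝ) : ℂ) • (1 : Matrix (Fin 4) (Fin 4) ℂ))
    (A : Matrix (TorusSite 4 L × n × Fin 4) (TorusSite 4 L × n × Fin 4) ℂ)
    (hA : A * ((Matrix.of fun x k : TorusSite 4 L => ((L : ℂ) ^ 2)⁻¹ * torusChar k x) ⊗ₖ
        (1 : Matrix (n × Fin 4) (n × Fin 4) ℂ)) =
      Matrix.of fun p q : TorusSite 4 L × n × Fin 4 =>
        (Matrix.of fun x k : TorusSite 4 L => ((L : ℂ) ^ 2)⁻¹ * torusChar k x) p.1 q.1 *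
          ((1 : Matrix n n ℂ) ⊗ₖ S q.1) p.2 q.2) :
    ‖A.det‖ ^ 2 = ∏ k, d k ^ (4 * Fintype.card n) := by
  have hd : (A * ((Matrix.of fun x k : TorusSite 4 L => ((L : ℂ) ^ 2)⁻¹ * torusChar k x) ⊗ₖ
        (1 : Matrix (n × Fin 4) (n × Fin 4) ℂ)))ᴴ *
      (A * ((Matrix.of fun x k : TorusSite 4 L => ((L : ℂ) ^ 2)⁻¹ * torusChar k x) ⊗ₖ
        (1 : Matrix (n × Fin 4) (n × Fin 4) ℂ))) =
      Matrix.diagonal fun q : TorusSite 4 L × n × Fin 4 => ((d q.1 : ℝ) : ℂ) := by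
    rw [hA]; exact symQ_conjTranspose_mul_self_of S d hS
  rw [norm_sq_det_of_diag _ A (fun q => d q.1) planeP_conjTranspose_mul_self hd,
    Fintype.prod_prod_type]
  refine Finset.prod_congr rfl fun k _ => ?_
  dsimp only
  rw [Finset.prod_const, Finset.card_univ, Fintype.card_prod, Fintype.card_fin, mul_comm]

/-- **Coercivity from a plane-wave diagonalisation.**  Under the hypotheses of
`norm_sq_det_of_planeWave`, `c ≤ d` on the momentum grid implies `c Σ_i ‖v_i‖² ≤ Σ_i ‖(A v)_i‖²`
(`A = Q Pᴴ`, `Qᴴ Q = diagonal (d ∘ fst)`, `P Pᴴ = 1`). -/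
theorem coercive_of_planeWave (S : TorusSite 4 L → Matrix (Fin 4) (Fin 4) ℂ)
    (d : TorusSite 4 L → ℝ)
    (hS : ∀ k, (S k)ᴴ * S k = ((d k : ℝ) : ℂ) • (1 : Matrix (Fin 4) (Fin 4) ℂ))
    (A : Matrix (TorusSite 4 L × n × Fin 4) (TorusSite 4 L × n × Fin 4) ℂ)
    (hA : A * ((Matrix.of fun x k : TorusSite 4 L => ((L : ℂ) ^ 2)⁻¹ * torusChar k x) ⊗ₖ
        (1 : Matrix (n × Fin 4) (n × Fin 4) ℂ)) =
      Matrix.of fun p q : TorusSite 4 L × n × Fin 4 =>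
        (Matrix.of fun x k : TorusSite 4 L => ((L : ℂ) ^ 2)⁻¹ * torusChar k x) p.1 q.1 *
          ((1 : Matrix n n ℂ) ⊗ₖ S q.1) p.2 q.2)
    (c : ℝ) (hc : ∀ k, c ≤ d k) (v : TorusSite 4 L × n × Fin 4 → ℂ) :
    c * ∑ i, ‖v i‖ ^ 2 ≤ ∑ i, ‖(A *ᵥ v) i‖ ^ 2 := by
  set P : Matrix (TorusSite 4 L × n × Fin 4) (TorusSite 4 L × n × Fin 4) ℂ :=
    ((Matrix.of fun x k : TorusSite 4 L => ((L : ℂ) ^ 2)⁻¹ * torusChar k x) ⊗ₖ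
        (1 : Matrix (n × Fin 4) (n × Fin 4) ℂ)) with hP
  have hd : (A * P)ᴴ * (A * P) =
      Matrix.diagonal fun q : TorusSite 4 L × n × Fin 4 => ((d q.1 : ℝ) : ℂ) := by
    rw [hA]; exact symQ_conjTranspose_mul_self_of S d hS
  have hPu : Pᴴ * P = 1 := by rw [hP]; exact planeP_conjTranspose_mul_self
  have hPP : P * Pᴴ = 1 := mul_eq_one_comm.1 hPu
  have hAv : A *ᵥ v = (A * P) *ᵥ (Pᴴ *ᵥ v) := by
    rw [Matrix.mulVec_mulVec, Matrix.mul_assoc, hPP, Matrix.mul_one]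
  have h1 : ∑ i, ‖((A * P) *ᵥ (Pᴴ *ᵥ v)) i‖ ^ 2 = ∑ q, d q.1 * ‖(Pᴴ *ᵥ v) q‖ ^ 2 :=
    sum_norm_sq_mulVec_of_gram_diagonal (A * P) (fun q => d q.1) hd _
  have h2 : ∑ q, ‖(Pᴴ *ᵥ v) q‖ ^ 2 = ∑ i, ‖v i‖ ^ 2 := by
    rw [sum_norm_sq_mulVec_of_conjTranspose_mul_self Pᴴ 1
      (by rw [Matrix.conjTranspose_conjTranspose, hPP, Complex.ofReal_one, one_smul]) v, one_mul]
  rw [hAv, h1, ← h2, Finset.mul_sum]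
  exact Finset.sum_le_sum fun q _ => mul_le_mul_of_nonneg_right (hc q.1) (sq_nonneg _)

/-- If `A P = Q` (`P = F ⊗ 1` the plane-wave matrix, `Q` as in `symQ_conjTranspose_mul_self_of`) with
normalised spin blocks `S(k)ᴴ S(k) = d(k)·1` and `d` vanishing nowhere, then `det A ≠ 0`. -/
theorem det_ne_zero_of_planeWave (S : TorusSite 4 L → Matrix (Fin 4) (Fin 4) ℂ) (d : TorusSite 4 L → ℝ)
    (hS : ∀ k, (S k)ᴴ * S k = ((d k : ℝ) : ℂ) • (1 : Matrix (Fin 4) (Fin 4) ℂ)) (hd0 : ∀ k, d k ≠ 0)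
    (A : Matrix (TorusSite 4 L × n × Fin 4) (TorusSite 4 L × n × Fin 4) ℂ)
    (hA : A * ((Matrix.of fun x k : TorusSite 4 L => ((L : ℂ) ^ 2)⁻¹ * torusChar k x) ⊗ₖ
        (1 : Matrix (n × Fin 4) (n × Fin 4) ℂ)) =
      Matrix.of fun p q : TorusSite 4 L × n × Fin 4 =>
        (Matrix.of fun x k : TorusSite 4 L => ((L : ℂ) ^ 2)⁻¹ * torusChar k x) p.1 q.1 *
          ((1 : Matrix n n ℂ) ⊗ₖ S q.1) p.2 q.2) :
    A.det ≠ 0 := by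
  have hd : (A * ((Matrix.of fun x k : TorusSite 4 L => ((L : ℂ) ^ 2)⁻¹ * torusChar k x) ⊗ₖ
        (1 : Matrix (n × Fin 4) (n × Fin 4) ℂ)))ᴴ *
      (A * ((Matrix.of fun x k : TorusSite 4 L => ((L : ℂ) ^ 2)⁻¹ * torusChar k x) ⊗ₖ
        (1 : Matrix (n × Fin 4) (n × Fin 4) ℂ))) =
      diagonal fun q : TorusSite 4 L × n × Fin 4 => ((d q.1 : ℝ) : ℂ) := by
    rw [hA]; exact symQ_conjTranspose_mul_self_of S d hS
  exact det_ne_zero_of_diag _ A (fun q => d q.1) hd fun q => hd0 q.1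

/-- **`(AᴴA)⁻¹` in Fourier variables**: under the hypotheses of `det_ne_zero_of_planeWave`,
`(AᴴA)⁻¹((x,s),(y,s')) = δ_{ss'} · L⁻⁴ Σ_k χ_k(x) conj χ_k(y) / d(k)`. -/
theorem inv_gram_apply_of_planeWave (S : TorusSite 4 L → Matrix (Fin 4) (Fin 4) ℂ) (d : TorusSite 4 L → ℝ)
    (hS : ∀ k, (S k)ᴴ * S k = ((d k : ℝ) : ℂ) • (1 : Matrix (Fin 4) (Fin 4) ℂ)) (hd0 : ∀ k, d k ≠ 0)
    (A : Matrix (TorusSite 4 L × n × Fin 4) (TorusSite 4 L × n × Fin 4) ℂ)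
    (hA : A * ((Matrix.of fun x k : TorusSite 4 L => ((L : ℂ) ^ 2)⁻¹ * torusChar k x) ⊗ₖ
        (1 : Matrix (n × Fin 4) (n × Fin 4) ℂ)) =
      Matrix.of fun p q : TorusSite 4 L × n × Fin 4 =>
        (Matrix.of fun x k : TorusSite 4 L => ((L : ℂ) ^ 2)⁻¹ * torusChar k x) p.1 q.1 *
          ((1 : Matrix n n ℂ) ⊗ₖ S q.1) p.2 q.2)
    (p q : TorusSite 4 L × n × Fin 4) :
    (Aᴴ * A)⁻¹ p q =
      if p.2 = q.2 then ((L : ℂ) ^ 4)⁻¹ * ∑ k, torusChar k p.1 * conj (torusChar k q.1) / ((d k : ℝ) : ℂ)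
      else 0 := by
  set P : Matrix (TorusSite 4 L × n × Fin 4) (TorusSite 4 L × n × Fin 4) ℂ :=
    ((Matrix.of fun x k : TorusSite 4 L => ((L : ℂ) ^ 2)⁻¹ * torusChar k x) ⊗ₖ
        (1 : Matrix (n × Fin 4) (n × Fin 4) ℂ)) with hP
  have hd : (A * P)ᴴ * (A * P) = diagonal fun q : TorusSite 4 L × n × Fin 4 => ((d q.1 : ℝ) : ℂ) := by
    rw [hA]; exact symQ_conjTranspose_mul_self_of S d hS
  have hPu : Pᴴ * P = 1 := by rw [hP]; exact planeP_conjTranspose_mul_self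
  obtain ⟨x, sa⟩ := p
  obtain ⟨y, sb⟩ := q
  rw [inv_conjTranspose_mul_self_apply P A (fun q => d q.1) hPu hd (fun q => hd0 q.1),
    Fintype.sum_prod_type]
  dsimp only
  have hs : ∀ (k : TorusSite 4 L) (s : n × Fin 4),
      P (x, sa) (k, s) * (((d k : ℝ) : ℂ))⁻¹ * conj (P (y, sb) (k, s)) =
        ((L : ℂ) ^ 4)⁻¹ * (torusChar k x * conj (torusChar k y) / ((d k : ℝ) : ℂ)) *
          ((1 : Matrix (n × Fin 4) (n × Fin 4) ℂ) sa s *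
            (1 : Matrix (n × Fin 4) (n × Fin 4) ℂ) s sb) := by
    intro k s
    rw [hP, Matrix.kroneckerMap_apply, Matrix.kroneckerMap_apply, Matrix.of_apply, Matrix.of_apply,
      map_mul, map_mul, conj_one_apply, map_inv₀, map_pow, map_natCast]
    ring
  simp_rw [hs]
  rw [← Finset.sum_mul_sum, ← Matrix.mul_apply, Matrix.one_mul, Matrix.one_apply, mul_ite, mul_one,
    mul_zero, ← Finset.mul_sum]

/-- **`A⁻¹` in Fourier variables**: under the hypotheses of `det_ne_zero_of_planeWave`,
`A⁻¹((x,a,α),(y,b,β)) = δ_{ab} · L⁻⁴ Σ_k χ_k(x) conj χ_k(y) (S(k)ᴴ)_{αβ} / d(k)` (`A⁻¹ = P·diag(1/d)·Qᴴ`). -/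
theorem inv_apply_of_planeWave (S : TorusSite 4 L → Matrix (Fin 4) (Fin 4) ℂ) (d : TorusSite 4 L → ℝ)
    (hS : ∀ k, (S k)ᴴ * S k = ((d k : ℝ) : ℂ) • (1 : Matrix (Fin 4) (Fin 4) ℂ)) (hd0 : ∀ k, d k ≠ 0)
    (A : Matrix (TorusSite 4 L × n × Fin 4) (TorusSite 4 L × n × Fin 4) ℂ)
    (hA : A * ((Matrix.of fun x k : TorusSite 4 L => ((L : ℂ) ^ 2)⁻¹ * torusChar k x) ⊗ₖ
        (1 : Matrix (n × Fin 4) (n × Fin 4) ℂ)) =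
      Matrix.of fun p q : TorusSite 4 L × n × Fin 4 =>
        (Matrix.of fun x k : TorusSite 4 L => ((L : ℂ) ^ 2)⁻¹ * torusChar k x) p.1 q.1 *
          ((1 : Matrix n n ℂ) ⊗ₖ S q.1) p.2 q.2)
    (p q : TorusSite 4 L × n × Fin 4) :
    A⁻¹ p q =
      if p.2.1 = q.2.1 then
        ((L : ℂ) ^ 4)⁻¹ * ∑ k, torusChar k p.1 * conj (torusChar k q.1) * (S k)ᴴ p.2.2 q.2.2 / ((d k : ℝ) : ℂ)
      else 0 := by
  set P : Matrix (TorusSite 4 L × n × Fin 4) (TorusSite 4 L × n × Fin 4) ℂ :=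
    ((Matrix.of fun x k : TorusSite 4 L => ((L : ℂ) ^ 2)⁻¹ * torusChar k x) ⊗ₖ
        (1 : Matrix (n × Fin 4) (n × Fin 4) ℂ)) with hP
  have hd : (A * P)ᴴ * (A * P) = diagonal fun q : TorusSite 4 L × n × Fin 4 => ((d q.1 : ℝ) : ℂ) := by
    rw [hA]; exact symQ_conjTranspose_mul_self_of S d hS
  have hPu : Pᴴ * P = 1 := by rw [hP]; exact planeP_conjTranspose_mul_self
  obtain ⟨x, a, α⟩ := p
  obtain ⟨y, b, β⟩ := q
  rw [inv_apply_of_diag P A (fun q => d q.1) hPu hd (fun q => hd0 q.1), hA, Fintype.sum_prod_type]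
  dsimp only
  have hs : ∀ (k : TorusSite 4 L) (s : n × Fin 4),
      P (x, a, α) (k, s) * (((d k : ℝ) : ℂ))⁻¹ *
          conj ((Matrix.of fun p q : TorusSite 4 L × n × Fin 4 =>
            (Matrix.of fun x k : TorusSite 4 L => ((L : ℂ) ^ 2)⁻¹ * torusChar k x) p.1 q.1 *
              ((1 : Matrix n n ℂ) ⊗ₖ S q.1) p.2 q.2) (y, b, β) (k, s)) =
        ((L : ℂ) ^ 4)⁻¹ * (torusChar k x * conj (torusChar k y) / ((d k : ℝ) : ℂ)) *
          ((1 : Matrix (n × Fin 4) (n × Fin 4) ℂ) (a, α) s *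
            ((1 : Matrix n n ℂ) ⊗ₖ S k)ᴴ s (b, β)) := by
    intro k s
    rw [Matrix.conjTranspose_apply, Complex.star_def]
    simp only [hP, Matrix.kroneckerMap_apply, Matrix.of_apply, map_mul, conj_one_apply, map_inv₀, map_pow,
      map_natCast]
    ring
  simp_rw [hs, ← Finset.mul_sum, ← Matrix.mul_apply, Matrix.one_mul, conjTranspose_kronecker,
    conjTranspose_one, Matrix.kroneckerMap_apply, Matrix.one_apply]
  split_ifs with hab
  · rw [Finset.mul_sum]
    refine Finset.sum_congr rfl fun k _ => ?_
    ring
  · simp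

end PlaneWave

/-- **Registered sub-goal of this auxiliary file** (`stub_freeTwistedFourierAuxAllN`, the colour-generic
plane-wave inversion bundle): if `A P = Q` for the unitary plane-wave matrix `P = F ⊗ 1`,
`F(x,k) = L⁻² χ_k(x)`, `Q(p,q) = F(p.1,q.1) · (1_n ⊗ S(q.1))(p.2,q.2)` with normalised spin blocks
`S(k)ᴴ S(k) = d(k)·1` (`d` real, ANY finite colour index `n`), then `‖det A‖² = ∏_k d(k)^{4|n|}`,
`c ≤ d ⇒ c Σ‖v‖² ≤ Σ‖Av‖²`, and for `d ≠ 0`: `det A ≠ 0`,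
`(AᴴA)⁻¹((x,s),(y,s')) = δ_{ss'} L⁻⁴ Σ_k χ_k(x) conj χ_k(y) / d(k)`,
`A⁻¹((x,a,α),(y,b,β)) = δ_{ab} L⁻⁴ Σ_k χ_k(x) conj χ_k(y) (S(k)ᴴ)_{αβ} / d(k)`. -/
theorem stub_freeTwistedFourierAuxAllN : ∀ (L : ℕ) [NeZero L] (n : Type) [Fintype n] [DecidableEq n] (S : TorusSite 4 L → Matrix (Fin 4) (Fin 4) ℂ) (d : TorusSite 4 L → ℝ), (∀ k, (S k)ᴴ * S k = ((d k : ℝ) : ℂ) • (1 : Matrix (Fin 4) (Fin 4) ℂ)) → ∀ (A : Matrix (TorusSite 4 L × n × Fin 4) (TorusSite 4 L × n × Fin 4) ℂ), A * ((Matrix.of fun x k : TorusSite 4 L => ((L : ℂ) ^ 2)⁻¹ * torusChar k x) ⊗ₖ (1 : Matrix (n × Fin 4) (n × Fin 4) ℂ)) = (Matrix.of fun p q : TorusSite 4 L × n × Fin 4 => (Matrix.of fun x k : TorusSite 4 L => ((L : ℂ) ^ 2)⁻¹ * torusChar k x) p.1 q.1 * ((1 : Matrix n n ℂ) ⊗ₖ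 S q.1) p.2 q.2) → ‖A.det‖ ^ 2 = ∏ k, d k ^ (4 * Fintype.card n) ∧ (∀ c : ℝ, (∀ k, c ≤ d k) → ∀ v : TorusSite 4 L × n × Fin 4 → ℂ, c * ∑ i, ‖v i‖ ^ 2 ≤ ∑ i, ‖(A.mulVec v) i‖ ^ 2) ∧ ((∀ k, d k ≠ 0) → A.det ≠ 0 ∧ (∀ p q : TorusSite 4 L × n × Fin 4, (Aᴴ * A)⁻¹ p q = if p.2 = q.2 then ((L : ℂ) ^ 4)⁻¹ * ∑ k, torusChar k p.1 * conj (torusChar k q.1) / ((d k : ℝ) : ℂ) else 0) ∧ (∀ p q : TorusSite 4 L × n × Fin 4, A⁻¹ p q = if p.2.1 = q.2.1 then ((L : ℂ) ^ 4)⁻¹ * ∑ k, torusChar k p.1 * conj (torusChar k q.1) * (S k)ᴴ p.2.2 q.2.2 / ((d k : ℝ) : ℂ) else 0)) := by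
  intro L _ n _ _ S d hS A hA
  exact ⟨norm_sq_det_of_planeWave S d hS A hA, fun c hc v => coercive_of_planeWave S d hS A hA c hc v,
    fun hd0 => ⟨det_ne_zero_of_planeWave S d hS hd0 A hA, inv_gram_apply_of_planeWave S d hS hd0 A hA,
      inv_apply_of_planeWave S d hS hd0 A hA⟩⟩

end

end Summit.QuantumFields.QCD.Cruxes.FlatCellOptimal.FreeTwistedFourier
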